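import Summits.AtomisticToContinuum.BoseEinsteinCondensation.Theses.BECStronglyRayleigh
import Literature.MathematicalPhysics.QuantumLattice.LiebMattisSectorPF
import Literature.MathematicalPhysics.QuantumLattice.XYOrderDischarges
import HarnessLib

/-!
# Matrix structure of the hard-core XXZ Hamiltonian with fields (lead hedge for stub F,
# `stub_sectorPerron`, line `stable-cone-variational-selection`, crux stmt-AtomisticToContinuum-9672)

`H = xxzHamiltonian 1 G (-1) Δ + Σ_x μ_x S³_x = -(heisenbergHamiltonian 1 G 1) + D` with `D` a real
diagonal matrix; hence `H` has real symmetric entries, nonpositive off the diagonal, and preserves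
the weight of configurations.
-/

noncomputable section

namespace Summit.AtomisticToContinuum.BoseEinsteinCondensation.Cruxes.GroundStateStability.StableConeVariationalSelection

open scoped BigOperators Matrix ComplexOrder
open Literature.MathematicalPhysics.QuantumLattice
open Matrix Finset Complex

section Structure

variable {Λ : Type*} [Fintype Λ] [DecidableEq Λ] (G : SimpleGraph Λ) [DecidableRel G.Adj]

/-- `S³_x` is diagonal in the occupation basis with entry `½ - σ_x`. [folklore] -/
theorem leadPF_siteSpin_two_eq_diagonal (x : Λ) :
    (siteSpin 1 x 2 : Op Λ 2) = diagonal fun σ => (1 : ℂ) / 2 - ((σ x : ℕ) : ℂ) := by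
  rw [siteSpin, spinVec_two, SpinOperators.spinZ, LiebMattis.onSite_diagonal]
  simp only [Nat.cast_one]

/-- `SᶻSᶻ` bonds are diagonal: `spinBond 1 2 x y = diag((½ - σ_x)(½ - σ_y))`. [folklore] -/
theorem leadPF_spinBond_two_eq_diagonal (x y : Λ) :
    (spinBond 1 2 x y : Op Λ 2) =
      diagonal fun σ => ((1 : ℂ) / 2 - ((σ x : ℕ) : ℂ)) * ((1 : ℂ) / 2 - ((σ y : ℕ) : ℂ)) := by
  rw [spinBond, leadPF_siteSpin_two_eq_diagonal, leadPF_siteSpin_two_eq_diagonal, diagonal_mul_diagonal,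
    diagonal_mul_diagonal, diagonal_add, ← diagonal_smul]
  congr 1
  funext σ
  simp only [Pi.smul_apply, smul_eq_mul]
  ring

/-- The diagonal part `D(σ) = (1-Δ) Σ_{xy∈E} (½-σ_x)(½-σ_y) + Σ_x μ_x (½-σ_x)` of the field XXZ
Hamiltonian, as a real function of the configuration. [folklore] -/
theorem leadPF_ham_eq (Δ : ℝ) (μ : Λ → ℝ) :
    (xxzHamiltonian 1 G (-1) Δ + ∑ x : Λ, ((μ x : ℝ) : ℂ) • siteSpin 1 x 2 : Op Λ 2) =
      -(heisenbergHamiltonian 1 G 1) +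
        diagonal fun σ => (((1 - Δ) * ∑ e ∈ G.edgeFinset,
            Sym2.lift ⟨fun x y => ((1 : ℝ) / 2 - (σ x : ℕ)) * ((1 : ℝ) / 2 - (σ y : ℕ)),
              fun _ _ => mul_comm _ _⟩ e +
          ∑ x : Λ, μ x * ((1 : ℝ) / 2 - (σ x : ℕ)) : ℝ) : ℂ) := by
  -- bond part
  have hbond : (xxzHamiltonian 1 G (-1) Δ : Op Λ 2) = -(heisenbergHamiltonian 1 G 1) +
      diagonal fun σ => (((1 - Δ) * ∑ e ∈ G.edgeFinset,
        Sym2.lift ⟨fun x y => ((1 : ℝ) / 2 - (σ x : ℕ)) * ((1 : ℝ) / 2 - (σ y : ℕ)),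
          fun _ _ => mul_comm _ _⟩ e : ℝ) : ℂ) := by
    have hd : (diagonal fun σ : TensorIndex Λ 2 => (((1 - Δ) * ∑ e ∈ G.edgeFinset,
        Sym2.lift ⟨fun x y => ((1 : ℝ) / 2 - (σ x : ℕ)) * ((1 : ℝ) / 2 - (σ y : ℕ)),
          fun _ _ => mul_comm _ _⟩ e : ℝ) : ℂ)) =
        ((1 : ℂ) - Δ) • ∑ e ∈ G.edgeFinset,
          Sym2.lift ⟨fun x y => (spinBond 1 2 x y : Op Λ 2), fun x y => (spinBond_comm 1 2 x y).symm⟩ e := by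
      have hsum : (∑ e ∈ G.edgeFinset,
          Sym2.lift ⟨fun x y => (spinBond 1 2 x y : Op Λ 2), fun x y => (spinBond_comm 1 2 x y).symm⟩ e) =
          diagonal fun σ : TensorIndex Λ 2 => ((∑ e ∈ G.edgeFinset,
            Sym2.lift ⟨fun x y => ((1 : ℝ) / 2 - (σ x : ℕ)) * ((1 : ℝ) / 2 - (σ y : ℕ)),
              fun _ _ => mul_comm _ _⟩ e : ℝ) : ℂ) := by
        ext σ τ
        rw [Matrix.sum_apply, diagonal_apply]
        push_cast
        split_ifs with h
        · subst h
          refine Finset.sum_congr rfl fun e _ => ?_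
          induction e using Sym2.ind with
          | h x y =>
            simp only [Sym2.lift_mk]
            rw [leadPF_spinBond_two_eq_diagonal, diagonal_apply_eq]
            push_cast
            ring
        · refine Finset.sum_eq_zero fun e _ => ?_
          induction e using Sym2.ind with
          | h x y =>
            simp only [Sym2.lift_mk]
            rw [leadPF_spinBond_two_eq_diagonal, diagonal_apply_ne _ h]
      rw [hsum, smul_eq_diagonal_mul, diagonal_mul_diagonal]
      congr 1
      funext σ
      push_cast
      ring
    rw [hd, xxzHamiltonian, heisenbergHamiltonian]
    push_cast
    rw [neg_smul, one_smul, one_smul, ← Finset.sum_neg_distrib, Finset.smul_sum, ← Finset.sum_neg_distrib,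
      ← Finset.sum_add_distrib]
    refine Finset.sum_congr rfl fun e _ => ?_
    induction e using Sym2.ind with
    | h x y =>
      simp only [Sym2.lift_mk, spinDotSym_mk, spinDot, Fin.sum_univ_three]
      module
  -- field part
  have hfield : (∑ x : Λ, ((μ x : ℝ) : ℂ) • siteSpin 1 x 2 : Op Λ 2) =
      diagonal fun σ => ((∑ x : Λ, μ x * ((1 : ℝ) / 2 - (σ x : ℕ)) : ℝ) : ℂ) := by
    ext σ τ
    rw [Matrix.sum_apply, diagonal_apply]
    push_cast
    split_ifs with h
    · subst h
      refine Finset.sum_congr rfl fun x _ => ?_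
      rw [Matrix.smul_apply, leadPF_siteSpin_two_eq_diagonal, diagonal_apply_eq, smul_eq_mul]
    · refine Finset.sum_eq_zero fun x _ => ?_
      rw [Matrix.smul_apply, leadPF_siteSpin_two_eq_diagonal, diagonal_apply_ne _ h, smul_zero]
  rw [hbond, hfield, add_assoc, diagonal_add]
  congr 2
  funext σ
  push_cast
  rfl

/-- The field XXZ Hamiltonian is Hermitian (real couplings, real fields). [folklore] -/
theorem leadPF_isHermitian (Δ : ℝ) (μ : Λ → ℝ) :
    (xxzHamiltonian 1 G (-1) Δ + ∑ x : Λ, ((μ x : ℝ) : ℂ) • siteSpin 1 x 2 : Op Λ 2).IsHermitian := by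
  refine (xxzHamiltonian_isHermitian 1 G (-1) Δ).add ?_
  rw [Matrix.IsHermitian, Matrix.conjTranspose_sum]
  refine Finset.sum_congr rfl fun x _ => ?_
  exact (Matrix.IsHermitian.smul (siteSpin_isHermitian 1 x 2)
    (by rw [isSelfAdjoint_iff, Complex.star_def, Complex.conj_ofReal])).eq

/-- **Entries of the field XXZ Hamiltonian** `H = -H_Heis(J=1) + diag(d)`: real, symmetric,
nonpositive off the diagonal (`-½` per allowed hop), and zero between different weights.
[folklore] -/
theorem leadPF_entries (Δ : ℝ) (μ : Λ → ℝ) :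
    (∀ σ τ : TensorIndex Λ 2, σ ≠ τ →
      (xxzHamiltonian 1 G (-1) Δ + ∑ x : Λ, ((μ x : ℝ) : ℂ) • siteSpin 1 x 2 : Op Λ 2) σ τ =
        -(heisenbergHamiltonian 1 G 1 σ τ)) ∧
    (∀ σ τ : TensorIndex Λ 2,
      star ((xxzHamiltonian 1 G (-1) Δ + ∑ x : Λ, ((μ x : ℝ) : ℂ) • siteSpin 1 x 2 : Op Λ 2) σ τ) =
        (xxzHamiltonian 1 G (-1) Δ + ∑ x : Λ, ((μ x : ℝ) : ℂ) • siteSpin 1 x 2 : Op Λ 2) σ τ) ∧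
    (∀ σ τ : TensorIndex Λ 2,
      (xxzHamiltonian 1 G (-1) Δ + ∑ x : Λ, ((μ x : ℝ) : ℂ) • siteSpin 1 x 2 : Op Λ 2) σ τ =
        (xxzHamiltonian 1 G (-1) Δ + ∑ x : Λ, ((μ x : ℝ) : ℂ) • siteSpin 1 x 2 : Op Λ 2) τ σ) ∧
    (∀ σ τ : TensorIndex Λ 2, σ ≠ τ →
      ((xxzHamiltonian 1 G (-1) Δ + ∑ x : Λ, ((μ x : ℝ) : ℂ) • siteSpin 1 x 2 : Op Λ 2) σ τ).re ≤ 0) ∧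
    (∀ σ τ : TensorIndex Λ 2, (∑ z, (σ z : ℕ)) ≠ (∑ z, (τ z : ℕ)) →
      (xxzHamiltonian 1 G (-1) Δ + ∑ x : Λ, ((μ x : ℝ) : ℂ) • siteSpin 1 x 2 : Op Λ 2) σ τ = 0) := by
  have hd := leadPF_ham_eq G Δ μ
  set H : Op Λ 2 := xxzHamiltonian 1 G (-1) Δ + ∑ x : Λ, ((μ x : ℝ) : ℂ) • siteSpin 1 x 2 with hHdef
  have happ : ∀ σ τ : TensorIndex Λ 2, σ ≠ τ → H σ τ = -(heisenbergHamiltonian 1 G 1 σ τ) := by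
    intro σ τ hστ
    rw [hd, Matrix.add_apply, Matrix.neg_apply, diagonal_apply_ne _ hστ, add_zero]
  have hreal : ∀ σ τ : TensorIndex Λ 2, star (H σ τ) = H σ τ := by
    intro σ τ
    rw [hd, Matrix.add_apply, Matrix.neg_apply, star_add, star_neg,
      LiebMattis.star_heisenbergHamiltonian_apply, diagonal_apply]
    split_ifs
    · rw [Complex.star_def, Complex.conj_ofReal]
    · rw [star_zero]
  have hHerm : H.IsHermitian := leadPF_isHermitian G Δ μ
  have hsymm : ∀ σ τ : TensorIndex Λ 2, H σ τ = H τ σ := by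
    intro σ τ
    rw [← hHerm.apply σ τ, hreal]
  refine ⟨happ, hreal, hsymm, ?_, ?_⟩
  · intro σ τ hστ
    obtain ⟨t, ht0, ht⟩ := LiebMattis.heisenbergHamiltonian_apply_eq_real 1 G 1 zero_le_one hστ
    rw [happ σ τ hστ, ht, ← Complex.ofReal_neg, Complex.ofReal_re]
    linarith
  · intro σ τ hw
    have hστ : σ ≠ τ := fun h => hw (by rw [h])
    rw [happ σ τ hστ, LiebMattis.heisenbergHamiltonian_apply_eq_zero_of_weight_ne 1 G 1 hw, neg_zero]

end Structure

/-! ### The stub -/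

/-- **Stub F — Perron–Frobenius in a magnetisation sector of the hard-core (J = -1) XXZ model
with fields**, on a connected graph, for ANY real `Δ, μ` (no window): sector ground vectors are unique
up to scalars, and a nonzero entrywise-nonnegative vector of the sector that is an eigenvector of `H`
for some eigenvalue is a ground vector of the sector (pair it with the strictly positive ground
vector). The XXZ analogue of `LiebMattis.sector_perronFrobenius`: `H = -heisenbergHamiltonian 1 G 1 +
(diagonal)`, so off-diagonal entries are `-½ ≤ 0` per hop (no Marshall sign), entries real, sectors
invariant, hop graph of a weight sector connected (`LiebMattis.reflTransGen_subtype`); abstract PF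
`perronFrobenius_groundState_unique/_smul_pos` with the lower bound from `sector_groundState`.
[cite: LiebWuPhysicaA2003, §2, items 1–2] -/
theorem stub_sectorPerron :
    ∀ (Λ : Type) [Fintype Λ] [DecidableEq Λ] (G : SimpleGraph Λ) [DecidableRel G.Adj], G.Connected →
      ∀ (Δ : ℝ) (μ : Λ → ℝ) (M : ℝ) (ψ : TensorIndex Λ 2 → ℂ), ψ ∈ spinZSector 1 M → ψ ≠ 0 →
      (xxzHamiltonian 1 G (-1) Δ + ∑ x : Λ, ((μ x : ℝ) : ℂ) • siteSpin 1 x 2) *ᵥ ψ = ((lowestEnergyInSector 1 (xxzHamiltonian 1 G (-1) Δ + ∑ x : Λ, ((μ x : ℝ) : ℂ) • siteSpin 1 x 2) M : ℝ) : ℂ) • ψ →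
      (∀ φ : TensorIndex Λ 2 → ℂ, φ ∈ spinZSector 1 M →
        (xxzHamiltonian 1 G (-1) Δ + ∑ x : Λ, ((μ x : ℝ) : ℂ) • siteSpin 1 x 2) *ᵥ φ = ((lowestEnergyInSector 1 (xxzHamiltonian 1 G (-1) Δ + ∑ x : Λ, ((μ x : ℝ) : ℂ) • siteSpin 1 x 2) M : ℝ) : ℂ) • φ →
        ∃ c : ℂ, φ = c • ψ) ∧
      (∀ (φ : TensorIndex Λ 2 → ℂ) (E : ℂ), φ ∈ spinZSector 1 M →
        (∀ σ : TensorIndex Λ 2, 0 ≤ (φ σ).re ∧ (φ σ).im = 0) → φ ≠ 0 →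
        (xxzHamiltonian 1 G (-1) Δ + ∑ x : Λ, ((μ x : ℝ) : ℂ) • siteSpin 1 x 2) *ᵥ φ = E • φ → E = ((lowestEnergyInSector 1 (xxzHamiltonian 1 G (-1) Δ + ∑ x : Λ, ((μ x : ℝ) : ℂ) • siteSpin 1 x 2) M : ℝ) : ℂ)) := by
  intro Λ _ _ G _ hG Δ μ M ψ hψ hψ0 hHψ
  obtain ⟨happ, hreal, hsymm, hoff, hwt⟩ := leadPF_entries G Δ μ
  have hHerm := leadPF_isHermitian G Δ μ
  set H : Op Λ 2 := xxzHamiltonian 1 G (-1) Δ + ∑ x : Λ, ((μ x : ℝ) : ℂ) • siteSpin 1 x 2 with hHdef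
  -- the weight sector of `ψ`
  obtain ⟨σ₀, hσ₀⟩ := Function.ne_iff.1 hψ0
  set W : ℕ := ∑ z, (σ₀ z : ℕ) with hWdef
  have hM : M = ((Fintype.card Λ * 1 : ℕ) : ℝ) / 2 - W := by
    have h1 := (LiebMattis.mem_spinZSector_iff 1 M ψ).1 hψ σ₀ hσ₀
    rw [LiebMattis.magnetisation_eq_sub_weight] at h1
    apply Complex.ofReal_injective
    rw [← h1, hWdef]
    push_cast
    ring
  subst hM
  set K := spinZSector (Λ := Λ) 1 (((Fintype.card Λ * 1 : ℕ) : ℝ) / 2 - W) with hKdef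
  set E : ℝ := lowestEnergyInSector 1 H (((Fintype.card Λ * 1 : ℕ) : ℝ) / 2 - W) with hEdef
  have hK : ∀ v, v ∈ K ↔ ∀ σ, ¬(∑ z, (σ z : ℕ)) = W → v σ = 0 :=
    fun v => LiebMattis.mem_spinZSector_weight_iff 1 W v
  -- the sector lower bound
  obtain ⟨-, h2⟩ := sector_groundState H hHerm (fun σ => (∑ z, (σ z : ℕ)) = W) ⟨σ₀, rfl⟩
    (fun σ τ hσ hτ => hwt σ τ (by rw [hτ]; exact hσ)) K hK
  have hE : H.minEnergyOn K = E := rfl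
  rw [hE] at h2
  -- the compression of `H` to the sector
  set ι := {σ : TensorIndex Λ 2 // (∑ z, (σ z : ℕ)) = W}
  set B : Matrix ι ι ℂ := Matrix.of fun s t => H s.1 t.1 with hBdef
  have hBapply : ∀ s t : ι, B s t = H s.1 t.1 := fun s t => rfl
  have hBreal : ∀ s t : ι, star (B s t) = B s t := fun s t => hreal _ _
  have hBsymm : ∀ s t : ι, B s t = B t s := fun s t => hsymm _ _
  have hBoff : ∀ s t : ι, s ≠ t → (B s t).re ≤ 0 := fun s t hst =>
    hoff _ _ (fun h => hst (Subtype.ext h))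
  -- connectivity of the hop graph inside the sector (diagonal steps are irrelevant)
  have hBaux : ∀ s t : ι, heisenbergHamiltonian 1 G 1 s.1 t.1 ≠ 0 →
      (Matrix.of fun s t : ι => if s = t then (1 : ℂ) else B s t) s t ≠ 0 := by
    intro s t hst
    by_cases hst' : s = t
    · rw [Matrix.of_apply, if_pos hst']
      exact one_ne_zero
    · rw [Matrix.of_apply, if_neg hst', hBapply, happ _ _ (fun h => hst' (Subtype.ext h))]
      exact neg_ne_zero.2 hst
  have hconn : ∀ s t : ι, Relation.ReflTransGen (fun a b => B a b ≠ 0) s t := by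
    intro s t
    have h := LiebMattis.reflTransGen_subtype 1 G 1 hG one_pos W hBaux s t
    induction h with
    | refl => exact Relation.ReflTransGen.refl
    | @tail b c _ hbc ih =>
      by_cases hbc' : b = c
      · subst hbc'
        exact ih
      · refine ih.tail ?_
        rwa [Matrix.of_apply, if_neg hbc'] at hbc
  -- extension by zero and restriction
  have hext_mem : ∀ v : ι → ℂ,
      (fun σ => if h : (∑ z, (σ z : ℕ)) = W then v ⟨σ, h⟩ else 0) ∈ K := by
    intro v
    rw [hK]
    intro σ hσ
    rw [dif_neg hσ]
  have hdot : ∀ (v : ι → ℂ) (w : TensorIndex Λ 2 → ℂ),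
      star (fun σ => if h : (∑ z, (σ z : ℕ)) = W then v ⟨σ, h⟩ else 0) ⬝ᵥ w =
        star v ⬝ᵥ fun s => w s.1 := by
    intro v w
    rw [dotProduct, dotProduct, sum_eq_sum_subtype_of_support (fun σ => (∑ z, (σ z : ℕ)) = W)]
    · refine Finset.sum_congr rfl fun s _ => ?_
      rw [Pi.star_apply, Pi.star_apply, dif_pos s.2]
    · intro σ hσ
      rw [Pi.star_apply, dif_neg hσ, star_zero, zero_mul]
  have hHext : ∀ (v : ι → ℂ) (s : ι),
      (H *ᵥ fun σ => if h : (∑ z, (σ z : ℕ)) = W then v ⟨σ, h⟩ else 0) s.1 = (B *ᵥ v) s := by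
    intro v s
    rw [mulVec, dotProduct, mulVec, dotProduct,
      sum_eq_sum_subtype_of_support (fun σ => (∑ z, (σ z : ℕ)) = W)]
    · refine Finset.sum_congr rfl fun t _ => ?_
      rw [dif_pos t.2, hBapply, Subtype.coe_eta]
    · intro τ hτ
      rw [dif_neg hτ, mul_zero]
  have hEB : ∀ v : ι → ℂ, E * (star v ⬝ᵥ v).re ≤ (star v ⬝ᵥ B *ᵥ v).re := by
    intro v
    set φ : TensorIndex Λ 2 → ℂ :=
      fun σ => if h : (∑ z, (σ z : ℕ)) = W then v ⟨σ, h⟩ else 0 with hφdef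
    have hφφ : star φ ⬝ᵥ φ = star v ⬝ᵥ v := by
      rw [hφdef, hdot]
      congr 1
      funext s
      rw [dif_pos s.2]
    have hφH : star φ ⬝ᵥ H *ᵥ φ = star v ⬝ᵥ B *ᵥ v := by
      rw [hφdef, hdot]
      congr 1
      funext s
      rw [hHext]
    have := LiebMattis.mul_norm_le_of_unit_bound 1 H K h2 (hext_mem v)
    rw [hφφ, hφH] at this
    exact this
  have hres : ∀ φ : TensorIndex Λ 2 → ℂ, φ ∈ K → H *ᵥ φ = (E : ℂ) • φ →
      B *ᵥ (fun s : ι => φ s.1) = (E : ℂ) • fun s : ι => φ s.1 := by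
    intro φ hφ hHφ
    funext s
    rw [Pi.smul_apply, smul_eq_mul, mulVec, dotProduct]
    have h := congrFun hHφ s.1
    rw [Pi.smul_apply, smul_eq_mul, mulVec, dotProduct,
      sum_eq_sum_subtype_of_support (fun σ => (∑ z, (σ z : ℕ)) = W)] at h
    · exact h
    · intro τ hτ
      rw [(hK φ).1 hφ τ hτ, mul_zero]
  have hres0 : ∀ φ : TensorIndex Λ 2 → ℂ, φ ∈ K → φ ≠ 0 → (fun s : ι => φ s.1) ≠ 0 := by
    intro φ hφ hφ0 h
    apply hφ0
    funext σ
    by_cases hσ : (∑ z, (σ z : ℕ)) = W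
    · exact congrFun h ⟨σ, hσ⟩
    · exact (hK φ).1 hφ σ hσ
  refine ⟨?_, ?_⟩
  · -- (a) uniqueness of sector ground vectors
    intro φ hφ hHφ
    obtain ⟨c, hc⟩ := perronFrobenius_groundState_unique hBsymm hBreal hBoff hconn hEB
      (hres ψ hψ hHψ) (hres φ hφ hHφ) (hres0 ψ hψ hψ0)
    refine ⟨c, funext fun σ => ?_⟩
    by_cases hσ : (∑ z, (σ z : ℕ)) = W
    · have h := congrFun hc ⟨σ, hσ⟩
      simpa only [Pi.smul_apply, smul_eq_mul] using h
    · rw [Pi.smul_apply, smul_eq_mul, (hK ψ).1 hψ σ hσ, (hK φ).1 hφ σ hσ, mul_zero]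
  · -- (b) a nonnegative sector eigenvector is a ground vector: pair it with the positive one
    intro φ E' hφ hφnn hφ0 hHφ
    obtain ⟨c, -, hcpos⟩ := perronFrobenius_groundState_smul_pos hBsymm hBreal hBoff hconn hEB
      (hres ψ hψ hHψ) (hres0 ψ hψ hψ0)
    -- `⟨cψ, Hφ⟩` two ways
    have h1 : star (c • ψ) ⬝ᵥ (H *ᵥ φ) = E' * (star (c • ψ) ⬝ᵥ φ) := by
      rw [hHφ, dotProduct_smul, smul_eq_mul]
    have h2 : star (c • ψ) ⬝ᵥ (H *ᵥ φ) = (E : ℂ) * (star (c • ψ) ⬝ᵥ φ) := by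
      have h3 : star (c • ψ) ⬝ᵥ (H *ᵥ φ) = star (H *ᵥ (c • ψ)) ⬝ᵥ φ := by
        rw [dotProduct_mulVec, star_mulVec, hHerm.eq]
      rw [h3, mulVec_smul, hHψ, smul_comm, star_smul, Complex.star_def, Complex.conj_ofReal,
        smul_dotProduct, smul_eq_mul]
    -- `⟨cψ, φ⟩ > 0`
    have hterm : ∀ σ, 0 ≤ (star ((c • ψ) σ) * φ σ).re ∧ (star ((c • ψ) σ) * φ σ).im = 0 := by
      intro σ
      by_cases hσ : (∑ z, (σ z : ℕ)) = W
      · obtain ⟨hre, him⟩ := hcpos ⟨σ, hσ⟩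
        obtain ⟨hre', him'⟩ := hφnn σ
        rw [Pi.smul_apply, smul_eq_mul, Complex.star_def, Complex.mul_re, Complex.mul_im,
          Complex.conj_re, Complex.conj_im, him, him']
        exact ⟨by nlinarith, by ring⟩
      · rw [(hK φ).1 hφ σ hσ, mul_zero]
        simp
    obtain ⟨σ₁, hσ₁⟩ := Function.ne_iff.1 hφ0
    have hσ₁W : (∑ z, (σ₁ z : ℕ)) = W := by
      by_contra h
      exact hσ₁ ((hK φ).1 hφ σ₁ h)
    have hpos₁ : 0 < (star ((c • ψ) σ₁) * φ σ₁).re := by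
      obtain ⟨hre, him⟩ := hcpos ⟨σ₁, hσ₁W⟩
      obtain ⟨hre', him'⟩ := hφnn σ₁
      have hre'' : 0 < (φ σ₁).re := by
        rcases hre'.lt_or_eq with h | h
        · exact h
        · have hzero : φ σ₁ = 0 :=
            Complex.ext (by rw [Complex.zero_re]; exact h.symm) (by rw [Complex.zero_im]; exact him')
          exact absurd hzero hσ₁
      rw [Pi.smul_apply, smul_eq_mul, Complex.star_def, Complex.mul_re, Complex.conj_re,
        Complex.conj_im, him, him']
      nlinarith
    have hS : star (c • ψ) ⬝ᵥ φ ≠ 0 := by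
      intro h0
      have hre := congrArg Complex.re h0
      rw [dotProduct, Complex.re_sum, Complex.zero_re] at hre
      have : 0 < ∑ σ, (star ((c • ψ) σ) * φ σ).re :=
        Finset.sum_pos' (fun σ _ => (hterm σ).1) ⟨σ₁, Finset.mem_univ _, hpos₁⟩
      simp only [Pi.star_apply] at hre
      linarith
    exact mul_right_cancel₀ hS (h1.symm.trans h2)

end Summit.AtomisticToContinuum.BoseEinsteinCondensation.Cruxes.GroundStateStability.StableConeVariationalSelection
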